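import Summits.Ventures.AbcSig.Conjectures.LevelRaising128
import Literature.NumberTheory.EllipticCurves.QuadraticTwistProofs
import Literature.NumberTheory.EllipticCurves.HasseElementary

/-!
# Venture AbcSig — `a_q(E₁₂₈)` and its twists lie in `bs04Allowed q`; `CONJ_LR128_L1` is its existence clause

HONEST FRAMING. Support file of the computation cell `pub-abcsig` for its TYPED conjecture `CONJ_LR128_L1`
(`Conjectures/LevelRaising128.lean`); it proves unconditional ARITHMETIC facts about the elliptic curve
`E₁₂₈ : y² = x³ − x² − 2x + 2` (conductor `128`) and draws the consequence for the typed declaration (lead note R1 /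
referee ref-g35's reading, there made for `CONJ_LR32_L1`). Nothing here is a claim on ABC or any summit, and nothing
is proved about the conjecture itself.

WHAT IS PROVED.
* `apCubic_eq_trace` — GENERAL: for an odd prime `q` and an elliptic curve `E = ⟨0, c₂, 0, c₁, c₀⟩` over `ZMod q`, the
  cell's naive count `apCubic q c₂ c₁ c₀ = q − Σ_{x mod q} #{y : y² ≡ x³ + c₂x² + c₁x + c₀}` IS the trace
  `q + 1 − #E(ZMod q)` (Mathlib's points, with the point at infinity; via the tree's
  `WeierstrassCurve.natCard_point_eq_one_add_sum_quadraticChar`).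
* `trace_sq_le_of_ringChar_ne` — the integer form `(q + 1 − #E)² ≤ 4q` of the tree's Hasse theorem
  `WeierstrassCurve.abs_natCard_point_sub_le_of_ringChar_ne` (Manin/Knapp, characteristic `≠ 2, 3`).
* `curve128`, `two_dvd_natCard_curve128` — `E₁₂₈` over `ZMod q` has the rational point `(1, 0)` of order `2`, so
  `#E₁₂₈(ZMod q)` is even; `a128_even`, `a128_sq_le`, `a128_mem_bs04Allowed` (`q = 3` by `decide`), and
  `a128tw_mem_bs04Allowed` for the four twists (`χ(q) = ±1` at odd `q`; the coarse set is symmetric).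
* `CONJ_LR128_L1_of_exists`, `CONJ_LR128_L1_iff_exists` — for every model `M`, `CONJ_LR128_L1 M` is EQUIVALENT to
  its pure level-raising existence clause `∃ i f, CongruentTo M f n (a128tw i)`: the conjunct
  `M.ArisesMod f n bs04Allowed` carries no further content ([Rib90b, Thm 1] / [DT94] give existence for the intended
  model; the typed conjecture asserts nothing more).

References: [BS04] Bennett–Skinner, Canad. J. Math. 56 (2004), Lemma 4.2; Hasse's theorem via A. W. Knapp, *Elliptic
Curves* (1992) §X.3 (the tree's `HasseElementary`); Silverman AEC III.2.3 (2-torsion); cell records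
HOME/lead/CONJ-LEAN-SPEC.md (R1/R2), HOME/referee/lr32-l1-g35/.
-/

namespace Summit.Ventures.AbcSig.Conjectures

open Summit.Ventures.AbcSig

/-! ## General: the naive count is the trace; Hasse in integer form -/

/-- The defining congruence of `nsqCubic` read in `ZMod q`. -/
private theorem nsq_congr_iff' {q : ℕ} [Fact q.Prime] (c₂ c₁ c₀ x y : ℕ) (E : WeierstrassCurve (ZMod q))
    (h₂ : E.a₂ = c₂) (h₄ : E.a₄ = c₁) (h₆ : E.a₆ = c₀) :
    (y * y) % q = (x ^ 3 + c₂ * x ^ 2 + c₁ * x + c₀) % q ↔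
      ((y : ZMod q)) ^ 2 = (x : ZMod q) ^ 3 + E.a₂ * (x : ZMod q) ^ 2 + E.a₄ * (x : ZMod q) + E.a₆ := by
  rw [← ZMod.natCast_eq_natCast_iff', h₂, h₄, h₆]
  push_cast
  constructor <;> intro h <;> linear_combination h

/-- The cell's fibre count `nsqCubic q c₂ c₁ c₀ x` is `#{y : ZMod q | y² = x³ + c₂x² + c₁x + c₀}`. -/
private theorem nsqCubic_eq_card {q : ℕ} [Fact q.Prime] (c₂ c₁ c₀ x : ℕ) (E : WeierstrassCurve (ZMod q))
    (h₂ : E.a₂ = c₂) (h₄ : E.a₄ = c₁) (h₆ : E.a₆ = c₀) :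
    nsqCubic q c₂ c₁ c₀ x = (Finset.univ.filter fun y : ZMod q =>
      y ^ 2 = (x : ZMod q) ^ 3 + E.a₂ * (x : ZMod q) ^ 2 + E.a₄ * (x : ZMod q) + E.a₆).card := by
  unfold nsqCubic
  refine Finset.card_bij (fun y _ => (y : ZMod q)) ?_ ?_ ?_
  · intro y hy
    simp only [Finset.mem_filter, Finset.mem_range, Finset.mem_univ, true_and] at hy ⊢
    exact (nsq_congr_iff' c₂ c₁ c₀ x y E h₂ h₄ h₆).mp hy.2
  · intro y₁ hy₁ y₂ hy₂ h
    simp only [Finset.mem_filter, Finset.mem_range] at hy₁ hy₂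
    have h' := (ZMod.natCast_eq_natCast_iff' y₁ y₂ q).mp h
    rwa [Nat.mod_eq_of_lt hy₁.1, Nat.mod_eq_of_lt hy₂.1] at h'
  · intro z hz
    simp only [Finset.mem_filter, Finset.mem_univ, true_and] at hz
    refine ⟨z.val, ?_, ZMod.natCast_zmod_val z⟩
    simp only [Finset.mem_filter, Finset.mem_range]
    refine ⟨ZMod.val_lt z, (nsq_congr_iff' c₂ c₁ c₀ x z.val E h₂ h₄ h₆).mpr ?_⟩
    rw [ZMod.natCast_zmod_val]
    exact hz

/-- Re-indexing `Σ_{x < q} g(x mod q) = Σ_{j : ZMod q} g j`. -/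
private theorem sum_range_natCast_eq {q : ℕ} [NeZero q] (g : ZMod q → ℤ) :
    ∑ x ∈ Finset.range q, g (x : ZMod q) = ∑ j : ZMod q, g j := by
  refine Finset.sum_nbij' (fun x : ℕ => (x : ZMod q)) (fun j : ZMod q => j.val) ?_ ?_ ?_ ?_ ?_
  · intro x _; exact Finset.mem_univ _
  · intro j _; exact Finset.mem_range.mpr (ZMod.val_lt j)
  · intro x hx
    rw [Finset.mem_range] at hx
    rw [ZMod.val_natCast, Nat.mod_eq_of_lt hx]
  · intro j _; exact ZMod.natCast_zmod_val j
  · intro x _; rfl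

/-- **The naive count is the trace of Frobenius.** For an odd prime `q` and an elliptic curve
`E = ⟨0, c₂, 0, c₁, c₀⟩` over `ZMod q` (coefficients given as natural residues), `apCubic q c₂ c₁ c₀ = q + 1 − #E(ZMod q)`. -/
theorem apCubic_eq_trace {q : ℕ} [Fact q.Prime] (hq2 : q ≠ 2) (c₂ c₁ c₀ : ℕ) (E : WeierstrassCurve (ZMod q))
    [E.IsElliptic] (h₁ : E.a₁ = 0) (h₃ : E.a₃ = 0) (h₂ : E.a₂ = c₂) (h₄ : E.a₄ = c₁) (h₆ : E.a₆ = c₀) :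
    apCubic q c₂ c₁ c₀ = (q : ℤ) + 1 - (Nat.card E.toAffine.Point : ℤ) := by
  classical
  have hchar : ringChar (ZMod q) ≠ 2 := by rw [ZMod.ringChar_zmod_n]; exact hq2
  have hcard := E.natCard_point_eq_one_add_sum_quadraticChar h₁ h₃ hchar
  have hfib : ∀ x : ℕ, (nsqCubic q c₂ c₁ c₀ x : ℤ) =
      quadraticChar (ZMod q) ((x : ZMod q) ^ 3 + E.a₂ * (x : ZMod q) ^ 2 + E.a₄ * (x : ZMod q) + E.a₆) + 1 := by
    intro x
    rw [← quadraticChar_card_sqrts hchar, Set.toFinset_setOf, nsqCubic_eq_card c₂ c₁ c₀ x E h₂ h₄ h₆]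
  have hsum : ∑ x ∈ Finset.range q, (nsqCubic q c₂ c₁ c₀ x : ℤ) =
      ∑ j : ZMod q, (quadraticChar (ZMod q) (j ^ 3 + E.a₂ * j ^ 2 + E.a₄ * j + E.a₆) + 1) := by
    rw [← sum_range_natCast_eq (fun j : ZMod q => quadraticChar (ZMod q) (j ^ 3 + E.a₂ * j ^ 2 + E.a₄ * j + E.a₆) + 1)]
    exact Finset.sum_congr rfl fun x _ => hfib x
  unfold apCubic
  rw [hsum, hcard]
  ring

/-- **Hasse's bound in integer form** for an elliptic curve over `ZMod q`, `q` a prime `≠ 2, 3`: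
`(q + 1 − #E(ZMod q))² ≤ 4q` (from the tree's `WeierstrassCurve.abs_natCard_point_sub_le_of_ringChar_ne`, Manin/Knapp). -/
theorem trace_sq_le_of_ringChar_ne {q : ℕ} [Fact q.Prime] (hq2 : q ≠ 2) (hq3 : q ≠ 3)
    (E : WeierstrassCurve (ZMod q)) [E.IsElliptic] :
    ((q : ℤ) + 1 - (Nat.card E.toAffine.Point : ℤ)) ^ 2 ≤ 4 * (q : ℤ) := by
  have h2 : ringChar (ZMod q) ≠ 2 := by rw [ZMod.ringChar_zmod_n]; exact hq2
  have h3 : ringChar (ZMod q) ≠ 3 := by rw [ZMod.ringChar_zmod_n]; exact hq3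
  have h := E.abs_natCard_point_sub_le_of_ringChar_ne h2 h3
  rw [ZMod.card] at h
  obtain ⟨hl, hr⟩ := abs_le.mp h
  have hsq := sq_le_sq' hl hr
  have h4 : (2 * Real.sqrt (q : ℝ)) ^ 2 = 4 * (q : ℝ) := by
    rw [mul_pow, Real.sq_sqrt (Nat.cast_nonneg q)]; norm_num
  rw [h4] at hsq
  have hR : (((q : ℤ) + 1 - (Nat.card E.toAffine.Point : ℤ)) ^ 2 : ℤ) ≤ ((4 * (q : ℤ) : ℤ)) := by
    have : (((q : ℝ) + 1 - (Nat.card E.toAffine.Point : ℝ)) ^ 2 : ℝ) ≤ 4 * (q : ℝ) := by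
      calc (((q : ℝ) + 1 - (Nat.card E.toAffine.Point : ℝ)) ^ 2 : ℝ)
          = ((Nat.card E.toAffine.Point : ℝ) - ((q : ℝ) + 1)) ^ 2 := by ring
        _ ≤ 4 * (q : ℝ) := hsq
    exact_mod_cast this
  exact hR

/-! ## The curve `E₁₂₈` over `ZMod q` -/

/-- `E₁₂₈ : y² = x³ − x² − 2x + 2` over `ZMod q` (Cremona `128a`-class Frey curve of the pseudo-solution `−1 + 2 = 1`;
`Δ = 2⁷`). -/
def curve128 (q : ℕ) : WeierstrassCurve (ZMod q) := ⟨0, -1, 0, -2, 2⟩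

/-- `Δ(E₁₂₈) = 2⁷`. -/
theorem curve128_Δ (q : ℕ) : (curve128 q).Δ = 2 ^ 7 := by
  simp only [curve128, WeierstrassCurve.Δ, WeierstrassCurve.b₂, WeierstrassCurve.b₄, WeierstrassCurve.b₆,
    WeierstrassCurve.b₈]
  ring

/-- For an odd prime `q`, `E₁₂₈` over `ZMod q` is elliptic. -/
theorem curve128_isElliptic {q : ℕ} [Fact q.Prime] (hq2 : q ≠ 2) : (curve128 q).IsElliptic := by
  rw [WeierstrassCurve.isElliptic_iff, curve128_Δ, isUnit_iff_ne_zero]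
  have h2 : ringChar (ZMod q) ≠ 2 := by rw [ZMod.ringChar_zmod_n]; exact hq2
  exact pow_ne_zero _ (Ring.two_ne_zero h2)

/-- **`a128` is the trace of Frobenius of `E₁₂₈`** at every odd prime `q`. -/
theorem a128_eq_trace {q : ℕ} [Fact q.Prime] (hq2 : q ≠ 2) :
    a128 q = (q : ℤ) + 1 - (Nat.card (curve128 q).toAffine.Point : ℤ) := by
  haveI := curve128_isElliptic hq2
  have hq2' : 2 ≤ q := (Fact.out : q.Prime).two_le
  refine apCubic_eq_trace hq2 (q - 1) (q - 2) 2 (curve128 q) rfl rfl ?_ ?_ ?_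
  · show (-1 : ZMod q) = ((q - 1 : ℕ) : ZMod q)
    rw [Nat.cast_sub (by omega), ZMod.natCast_self, Nat.cast_one, zero_sub]
  · show (-2 : ZMod q) = ((q - 2 : ℕ) : ZMod q)
    rw [Nat.cast_sub hq2', ZMod.natCast_self, Nat.cast_ofNat, zero_sub]
  · show (2 : ZMod q) = ((2 : ℕ) : ZMod q)
    rw [Nat.cast_ofNat]

/-- `#E₁₂₈(ZMod q)` is even for odd primes `q`: `(1, 0)` is a rational point of order `2`. -/
theorem two_dvd_natCard_curve128 {q : ℕ} [Fact q.Prime] (hq2 : q ≠ 2) :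
    2 ∣ Nat.card (curve128 q).toAffine.Point := by
  haveI := curve128_isElliptic hq2
  have heq : (curve128 q).toAffine.Equation 1 0 := by
    rw [WeierstrassCurve.Affine.equation_iff]
    simp only [curve128]
    ring
  set P : (curve128 q).toAffine.Point :=
    .some 1 0 ((WeierstrassCurve.Affine.equation_iff_nonsingular).mp heq) with hP
  have hneg : -P = P := by
    rw [hP, WeierstrassCurve.Affine.Point.neg_some]
    congr 1
    simp only [WeierstrassCurve.Affine.negY, curve128]
    ring
  have h2P : 2 • P = 0 := by
    rw [two_nsmul]
    nth_rewrite 1 [← hneg]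
    exact neg_add_cancel P
  have hord : addOrderOf P = 2 := addOrderOf_eq_prime h2P (WeierstrassCurve.Affine.Point.some_ne_zero _)
  rw [← hord]
  exact addOrderOf_dvd_natCard P

/-- **`a128(q)` is even** at every odd prime `q`. -/
theorem a128_even {q : ℕ} (hq : q.Prime) (hq2 : q ≠ 2) : a128 q % 2 = 0 := by
  haveI : Fact q.Prime := ⟨hq⟩
  have ha := a128_eq_trace hq2
  obtain ⟨m, hm⟩ := two_dvd_natCard_curve128 hq2
  have hq_odd : q % 2 = 1 := Nat.odd_iff.mp (hq.odd_of_ne_two hq2)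
  rw [hm] at ha
  push_cast at ha
  omega

/-- **Hasse for `E₁₂₈`**: `a128(q)² ≤ 4q` at every prime `q ≥ 5` (and at `q = 3` by computation). -/
theorem a128_sq_le {q : ℕ} (hq : q.Prime) (hq2 : q ≠ 2) : a128 q * a128 q ≤ 4 * (q : ℤ) := by
  by_cases hq3 : q = 3
  · subst hq3; decide
  haveI : Fact q.Prime := ⟨hq⟩
  haveI := curve128_isElliptic hq2
  rw [a128_eq_trace hq2, ← sq]
  exact trace_sq_le_of_ringChar_ne hq2 hq3 (curve128 q)

/-- **`a_q(E₁₂₈) ∈ bs04Allowed q` for every odd prime `q`.** -/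
theorem a128_mem_bs04Allowed (q : ℕ) (hq : q.Prime) (hq2 : q ≠ 2) : a128 q ∈ bs04Allowed q :=
  (mem_bs04Allowed_iff q (a128 q)).mpr (Or.inl ⟨a128_even hq hq2, a128_sq_le hq hq2⟩)

/-- The coarse set is symmetric: `t ∈ bs04Allowed q → −t ∈ bs04Allowed q`. -/
theorem neg_mem_bs04Allowed {q : ℕ} {t : ℤ} (h : t ∈ bs04Allowed q) : -t ∈ bs04Allowed q := by
  rw [mem_bs04Allowed_iff] at h ⊢
  rcases h with ⟨h1, h2⟩ | h
  · left; exact ⟨by omega, by nlinarith⟩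
  · right; rw [Int.natAbs_neg]; exact h

/-- At an odd `q` each of the four twisted systems is `± a128`. -/
theorem a128tw_eq_or_eq_neg (i : Fin 4) {q : ℕ} (hq : q % 2 = 1) :
    a128tw i q = a128 q ∨ a128tw i q = -a128 q := by
  have h2 : ¬ q % 2 = 0 := by omega
  fin_cases i
  · exact Or.inl rfl
  · simp only [a128tw, chiNeg4, if_neg h2]
    split_ifs <;> simp
  · simp only [a128tw, chi8, if_neg h2]
    split_ifs <;> simp
  · simp only [a128tw, chiNeg8, if_neg h2]
    split_ifs <;> simp

/-- **Each twisted system `a128tw i` has `a128tw i q ∈ bs04Allowed q` at every odd prime `q`.** -/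
theorem a128tw_mem_bs04Allowed (i : Fin 4) (q : ℕ) (hq : q.Prime) (hq2 : q ≠ 2) :
    a128tw i q ∈ bs04Allowed q := by
  have hq_odd : q % 2 = 1 := Nat.odd_iff.mp (hq.odd_of_ne_two hq2)
  rcases a128tw_eq_or_eq_neg i hq_odd with h | h <;> rw [h]
  · exact a128_mem_bs04Allowed q hq hq2
  · exact neg_mem_bs04Allowed (a128_mem_bs04Allowed q hq hq2)

/-! ## Consequence for the typed conjecture -/

/-- **Reduction of `CONJ_LR128_L1` to its existence clause** (the `CONJ_LR32_L1_of_exists` analogue, here with NO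
residual hypothesis): the congruence `CongruentTo M f n (a128tw i)` already gives `M.ArisesMod f n bs04Allowed` with
the same reduction map, because `a128tw i q ∈ bs04Allowed q` at every odd prime `q`. -/
theorem CONJ_LR128_L1_of_exists (M : NewformModel)
    (hex : ∀ ℓ n : ℕ, ℓ.Prime → 3 ≤ ℓ → n.Prime → 11 ≤ n → n ≠ ℓ → LevelRaise a128 ℓ n →
      ∃ i : Fin 4, ∃ f : M.Form (2 ^ 7 * ℓ), CongruentTo M f n (a128tw i)) :
    CONJ_LR128_L1 M := by
  intro ℓ n hℓ h3 hn h11 hnℓ hLR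
  obtain ⟨i, f, k, hk, hchar, ψ, hψ⟩ := hex ℓ n hℓ h3 hn h11 hnℓ hLR
  refine ⟨i, f, ⟨k, hk, hchar, ψ, hψ⟩, k, hk, hchar, ψ, ?_⟩
  intro q hq hq2 _ hqN
  exact ⟨a128tw i q, a128tw_mem_bs04Allowed i q hq hq2, hψ q hq hq2 hqN⟩

/-- **`CONJ_LR128_L1` is exactly its level-raising existence clause**, for every model `M`. -/
theorem CONJ_LR128_L1_iff_exists (M : NewformModel) :
    CONJ_LR128_L1 M ↔
      ∀ ℓ n : ℕ, ℓ.Prime → 3 ≤ ℓ → n.Prime → 11 ≤ n → n ≠ ℓ → LevelRaise a128 ℓ n →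
        ∃ i : Fin 4, ∃ f : M.Form (2 ^ 7 * ℓ), CongruentTo M f n (a128tw i) := by
  constructor
  · intro h ℓ n hℓ h3 hn h11 hnℓ hLR
    obtain ⟨i, f, hf, -⟩ := h ℓ n hℓ h3 hn h11 hnℓ hLR
    exact ⟨i, f, hf⟩
  · exact CONJ_LR128_L1_of_exists M

end Summit.Ventures.AbcSig.Conjectures
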